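import Literature.Geometry.Lorentzian.SchwarzschildKerrSchildComponents
import HarnessLib

/-!
# The Schwarzschild metric in ingoing Kerr–Schild Cartesian coordinates, II: the Koszul form
# (Christoffel symbols of the first kind) and its derivative in closed form

Support file (all results proved) for `Kerr.isRicciFlat M 0 r₀`
(`SchwarzschildKerrSchildRicciFlat.lean`). With the atoms of
`SchwarzschildKerrSchildComponents.lean` (`ℓ(V) = V⁰ + ⟪x⃗,V⃗⟫/r`, `ν(V) = ⟪x⃗,V⃗⟫/r`,
`P(V,W) = ⟪V⃗,W⃗⟫ − ν(V)ν(W)`, `r = ‖x⃗‖`):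

* `Schwarzschild.koszulForm_eq_kForm` — **the Christoffel symbols of the first kind** of the
  components `Kerr.bilin M 0` (`OpensChart.koszulForm` of `ChartCalculus.lean`,
  `K(Y; X, Z) = ∂_X g(Y,Z) + ∂_Y g(Z,X) − ∂_Z g(X,Y) = 2 g(∇_X Y, Z)`):
  `K(Y; X, Z) = (2M/r²) [2 P(X,Y) ℓ(Z) + ν(Z) ℓ(X) ℓ(Y) − (ν(X) ℓ(Y) + ν(Y) ℓ(X)) ℓ(Z)]`, i.e. in
  vector form `∇_X Y = (M/r²) [(2P(X,Y) − ν(X)ℓ(Y) − ν(Y)ℓ(X) − (2M/r) ℓ(X)ℓ(Y)) ℓ♯ + ℓ(X)ℓ(Y) n♯]`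
  with `ℓ♯ = (−1, n⃗)`, `n♯ = (0, n⃗)` (O'Neill 1983, Ch. 3, Prop. 3.13; Kerr–Schild 1965, §2);
* `Schwarzschild.fderiv_koszulForm_zero_spin` — the derivative `∂_V K(Y; X, Z)` in closed form
  (`Schwarzschild.dkForm`, the Leibniz expansion through `∂ℓ = ∂ν = P/r`, `∂P`), the `∂Γ` input of
  the coordinate formula for the curvature (`ChartConnection.val_riemann_eq`).

## References

* R. P. Kerr, A. Schild, *A new class of vacuum solutions of the Einstein field equations* (1965),
  §§2–3.
* B. O'Neill, *Semi-Riemannian geometry* (1983), Ch. 3, Prop. 3.13, Lemma 3.38.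
-/

noncomputable section

-- instance search through the nested operator types (as in `ChartCurvature`)
set_option maxSynthPendingDepth 3

open Bundle TopologicalSpace Manifold Set Module Filter
open scoped ContDiff Topology InnerProductSpace

namespace Literature.Geometry.Lorentzian

namespace Schwarzschild

variable {x : E4}

/-! ### The Koszul form (Christoffel symbols of the first kind) -/

/-- The bracket `Q(Y; X, Z) = 2 P(X,Y) ℓ(Z) + ν(Z) ℓ(X) ℓ(Y) − (ν(X) ℓ(Y) + ν(Y) ℓ(X)) ℓ(Z)`
of the Koszul form `K = (2M/r²) Q`. [cite: ONeill1983, Ch. 3, Prop. 3.13] -/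
def kCore (x Y X Z : E4) : ℝ :=
  2 * proj x X Y * ell x Z + nu x Z * ell x X * ell x Y - (nu x X * ell x Y + nu x Y * ell x X) * ell x Z

/-- The closed form `K(Y; X, Z) = (2M/r²) Q(Y; X, Z)` of the Koszul form of the Schwarzschild
components (`koszulForm_eq_kForm`). O'Neill 1983, Ch. 3, Prop. 3.13; Kerr–Schild 1965, §2.
[cite: ONeill1983, Ch. 3, Prop. 3.13] -/
def kForm (M : ℝ) (x Y X Z : E4) : ℝ := 2 * M / E4.spatialNorm x ^ 2 * kCore x Y X Z

/-- **The Christoffel symbols of the first kind of the Schwarzschild metric in Kerr–Schild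
coordinates.** Off the time axis the Koszul form of the components `Kerr.bilin M 0`
(`ChartCalculus.lean`: `K(Y; X, Z) = ∂_X g(Y,Z) + ∂_Y g(Z,X) − ∂_Z g(X,Y) = 2 g(∇_X Y, Z)`) is
`(2M/r²) [2 P(X,Y) ℓ(Z) + ν(Z) ℓ(X) ℓ(Y) − (ν(X) ℓ(Y) + ν(Y) ℓ(X)) ℓ(Z)]`, i.e.
`∇_X Y = (M/r²) [(2P(X,Y) − ν(X)ℓ(Y) − ν(Y)ℓ(X) − (2M/r) ℓ(X)ℓ(Y)) ℓ♯ + ℓ(X)ℓ(Y) n♯]`,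
`ℓ♯ = (−1, n⃗)`, `n♯ = (0, n⃗)`. O'Neill 1983, Ch. 3, Prop. 3.13; Kerr–Schild 1965, §2.
[cite: ONeill1983, Ch. 3, Prop. 3.13] -/
theorem koszulForm_eq_kForm (M : ℝ) (hx : E4.spatial x ≠ 0) (Y X Z : E4) :
    OpensChart.koszulForm (Kerr.bilin M 0) x Y X Z = kForm M x Y X Z := by
  have hr : E4.spatialNorm x ≠ 0 := by rwa [E4.spatialNorm, norm_ne_zero_iff]
  rw [OpensChart.koszulForm_apply, fderiv_bilin_zero_spin_apply M hx,
    fderiv_bilin_zero_spin_apply M hx, fderiv_bilin_zero_spin_apply M hx]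
  simp only [dG, dEll, kForm, kCore, proj, ell, nu, sdot_comm Y X, sdot_comm Z X, sdot_comm Z Y]
  field_simp
  ring

/-- Near a point off the time axis the Koszul form is `kForm` (as germs). [cite: ONeill1983, Ch. 3, Prop. 3.13] -/
theorem koszulForm_eventuallyEq_kForm (M : ℝ) (hx : E4.spatial x ≠ 0) (Y X Z : E4) :
    (fun y ↦ OpensChart.koszulForm (Kerr.bilin M 0) y Y X Z) =ᶠ[𝓝 x] fun y ↦ kForm M y Y X Z := by
  filter_upwards [isOpen_spatial_ne_zero.mem_nhds hx] with y hy
  exact koszulForm_eq_kForm M hy Y X Z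

/-! ### The derivative of the Koszul form -/

/-- The Leibniz expansion of `∂_V Q(Y; X, Z)` (`∂_V ℓ = ∂_V ν = dEll`, `∂_V P = dProj`).
[cite: ONeill1983, Ch. 3, Lemma 3.38] -/
def dkCore (x V Y X Z : E4) : ℝ :=
  2 * dProj x V X Y * ell x Z + 2 * proj x X Y * dEll x V Z +
    (dEll x V Z * ell x X * ell x Y + nu x Z * dEll x V X * ell x Y + nu x Z * ell x X * dEll x V Y) -
    ((dEll x V X * ell x Y + nu x X * dEll x V Y + (dEll x V Y * ell x X + nu x Y * dEll x V X)) *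
        ell x Z + (nu x X * ell x Y + nu x Y * ell x X) * dEll x V Z)

/-- The closed form of the derivative `∂_V K(Y; X, Z)` of the Koszul form:
`∂_V K = (∂_V (2M/r²)) Q + (2M/r²) ∂_V Q`, `∂_V (2M/r²) = −4M ⟪x⃗, V⃗⟫/r⁴`.
[cite: ONeill1983, Ch. 3, Lemma 3.38] -/
def dkForm (M : ℝ) (x V Y X Z : E4) : ℝ :=
  -(2 * M * 2) / E4.spatialNorm x ^ 4 * sdot x V * kCore x Y X Z +
    2 * M / E4.spatialNorm x ^ 2 * dkCore x V Y X Z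

/-- The derivative of `x ↦ Q_x(Y; X, Z)` as a continuous linear map (Leibniz rule on `kCore`).
[cite: ONeill1983, Ch. 3, Lemma 3.38] -/
def kCoreFD (x Y X Z : E4) : E4 →L[ℝ] ℝ :=
  (2 * proj x X Y) • ellFD x Z + ell x Z • ((2 : ℝ) • projFD x X Y) +
    ((nu x Z * ell x X) • ellFD x Y + ell x Y • (nu x Z • ellFD x X + ell x X • ellFD x Z)) -
    ((nu x X * ell x Y + nu x Y * ell x X) • ellFD x Z +
      ell x Z • ((nu x X • ellFD x Y + ell x Y • ellFD x X) + (nu x Y • ellFD x X + ell x X • ellFD x Y)))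

/-- **`x ↦ Q_x(Y; X, Z)` is differentiable off the time axis, with derivative `kCoreFD`.**
[cite: ONeill1983, Ch. 3, Lemma 3.38] -/
theorem hasFDerivAt_kCore (hx : E4.spatial x ≠ 0) (Y X Z : E4) :
    HasFDerivAt (fun x : E4 ↦ kCore x Y X Z) (kCoreFD x Y X Z) x :=
  ((((hasFDerivAt_proj hx X Y).const_mul 2).mul (hasFDerivAt_ell hx Z)).add
    (((hasFDerivAt_nu hx Z).mul (hasFDerivAt_ell hx X)).mul (hasFDerivAt_ell hx Y))).sub
    ((((hasFDerivAt_nu hx X).mul (hasFDerivAt_ell hx Y)).add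
      ((hasFDerivAt_nu hx Y).mul (hasFDerivAt_ell hx X))).mul (hasFDerivAt_ell hx Z))

/-- `kCoreFD x Y X Z V = ∂_V Q(Y; X, Z)`. [cite: ONeill1983, Ch. 3, Lemma 3.38] -/
theorem kCoreFD_apply (x Y X Z V : E4) : kCoreFD x Y X Z V = dkCore x V Y X Z := by
  simp only [kCoreFD, dkCore, add_apply, sub_apply,
    FunLike.coe_smul, Pi.smul_apply, ellFD_apply, projFD_apply, smul_eq_mul]
  ring

/-- **`x ↦ K_x(Y; X, Z)` is differentiable off the time axis**, with derivative
`V ↦ dkForm M x V Y X Z`. [cite: ONeill1983, Ch. 3, Lemma 3.38] -/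
theorem hasFDerivAt_kForm (M : ℝ) (hx : E4.spatial x ≠ 0) (Y X Z : E4) :
    HasFDerivAt (fun x : E4 ↦ kForm M x Y X Z)
      ((2 * M / E4.spatialNorm x ^ 2) • kCoreFD x Y X Z +
        kCore x Y X Z • ((-(2 * M * (2 : ℕ)) / E4.spatialNorm x ^ (2 + 2)) • sdotCLM x)) x :=
  (hasFDerivAt_const_div_spatialNorm_pow (2 * M) hx 2).mul (hasFDerivAt_kCore hx Y X Z)

/-- `∂_V K(Y; X, Z) = dkForm M x V Y X Z` off the time axis. [cite: ONeill1983, Ch. 3, Lemma 3.38] -/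
theorem fderiv_kForm_apply (M : ℝ) (hx : E4.spatial x ≠ 0) (Y X Z V : E4) :
    fderiv ℝ (fun y : E4 ↦ kForm M y Y X Z) x V = dkForm M x V Y X Z := by
  rw [(hasFDerivAt_kForm M hx Y X Z).fderiv]
  simp only [dkForm, add_apply, FunLike.coe_smul, Pi.smul_apply,
    sdotCLM_apply, kCoreFD_apply, smul_eq_mul]
  push_cast
  ring

/-- **The derivative of the Koszul form of the Schwarzschild components** (the `∂Γ` terms of the
coordinate formula for the curvature, `ChartConnection.val_riemann_eq`): off the time axis,
`∂_V K(Y; X, Z)(x) = dkForm M x V Y X Z`. O'Neill 1983, Ch. 3, Lemma 3.38. [cite: ONeill1983, Ch. 3, Lemma 3.38] -/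
theorem fderiv_koszulForm_zero_spin (M : ℝ) (hx : E4.spatial x ≠ 0) (Y X Z V : E4) :
    fderiv ℝ (fun y ↦ OpensChart.koszulForm (Kerr.bilin M 0) y Y X Z) x V = dkForm M x V Y X Z := by
  rw [(koszulForm_eventuallyEq_kForm M hx Y X Z).fderiv_eq, fderiv_kForm_apply M hx]

/-- The Koszul form of the Schwarzschild components is differentiable off the time axis.
[cite: ONeill1983, Ch. 3, Lemma 3.38] -/
theorem differentiableAt_koszulForm_zero_spin (M : ℝ) (hx : E4.spatial x ≠ 0) (Y X Z : E4) :
    DifferentiableAt ℝ (fun y ↦ OpensChart.koszulForm (Kerr.bilin M 0) y Y X Z) x :=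
  (hasFDerivAt_kForm M hx Y X Z).differentiableAt.congr_of_eventuallyEq
    (koszulForm_eventuallyEq_kForm M hx Y X Z)

end Schwarzschild

end Literature.Geometry.Lorentzian

end
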